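import Summits.ResolutionOfSingularities.ResolutionOfSingularities.Theorems.PurelyInseparableDim4ChartAtlasSNCDisjoint
import Summits.ResolutionOfSingularities.ResolutionOfSingularities.Theorems.PurelyInseparableDim4ChartAtlasSNCRepair
import Summits.ResolutionOfSingularities.ResolutionOfSingularities.Theorems.PurelyInseparableDim4ChartAtlasGlue
import Literature.AlgebraicGeometry.Resolution.BlowupSNC
import HarnessLib

/-!
# The S3-N2 REPAIR on the chart model, GLOBAL form: after ANY blowing up of `𝔸⁵` along `Σ = V(z, x_T, x_j)` the strict transform of
# the escaping centre `V(z, x_T)` has simple normal crossings with the transformed boundary (cell `res-dim4-pi`, typ-2 g5)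

[OURS · counted 0 · about OUR S3 (c) strategy; nothing about resolution of singularities] (D-0157 DOOR 2; DR-157-C; desk WORD #131 (c);
crit-3 g4 K-A3-26b/30 «open: W′-level HasSNCWith after repair»). ASSEMBLY of N3 (Σ snc with the bad pair), N5 (chart readings after
`Bl_Σ`), N6 (disjoint / dead members harmless) with the atlas GLUE (`hasSNCWith_of_cover_comap`) and the tree's
`HasSNCWith.hasSNC_transform` (Kollár 3.25: snc persists under admissible blow-ups). Setting: `𝔸⁵_K` (the chart-`x_l` model), centre of the
escaping child `Zc = 𝓘Λ_T`, boundary `E = x_j·𝒪 :: (x_m + b·x_j)·𝒪 :: [(xᵢ + cᵢ)·𝒪 : i ∈ l]` (`m ∈ T`, `j ∉ T`, `b ≠ 0`, `c = 0` on `T ∪ {j}`,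
`l ∌ m, j`, indices in `Fin 4`), `Σ = 𝓘Λ_{insert j T}`, `π' : W' → 𝔸⁵` ANY blowing up along `Σ`. PROVED here (no `sorry`, no new axiom):

* `strictTransformIdeal_translate_comap_chartImm` — chart reading of the strict transform of a transversal translated member;
* **`hasSNCWith_transform_boundary_strictTransform_after_repair`** — `HasSNCWith (E.map (St π') ++ [Σ·𝒪_{W'}]) (St π' Zc)`: AFTER THE
  REPAIR BLOW-UP THE STRICT TRANSFORM OF THE ESCAPING CENTRE IS SNC WITH THE WHOLE TRANSFORMED BOUNDARY — whereas before it `Zc` was NOT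
  snc with `E` (`not_hasSNCWith_of_shear_hyperplanes`, p690374).

HONEST SCOPE: the chart MODEL with constant-translated further members (off-`T` sheared further members: same proof with N4, not written);
regularity of `V(St Zc)` and `⊆ supp` of the transformed marked ideal are the other two admissibility clauses (regular: it reads `𝓘Λ_T` on its
one chart, `isRegular_subscheme_of_cover_comap`; supp: typ-3 g4's `isPermissibleCentre_chartTransform_of_not_mem`) — not bundled here; COST
of the extra blow-up for the walk's measure unbooked (planner). Resolution of singularities in dimension ≥ 4 / characteristic `p` is NOT proved
anywhere in this programme. bears_on: LADDER-RESOLUTION:D157-DOOR2 (res-dim4-pi). Supports stmt-ResolutionOfSingularities-16155 (helper,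
S3-N2 repair, global form on the model).
-/

-- every declaration of this summit lives under `Summit.ResolutionOfSingularities.ResolutionOfSingularities`
-- (summit = problem), which the duplicate-namespace linter flags; house convention (cf. the Target file).
set_option linter.dupNamespace false

noncomputable section

open MvPolynomial Finset CategoryTheory AlgebraicGeometry Opposite TopologicalSpace
open AlgebraicGeometry.Scheme.IdealSheafData (ofIdealTop vanishingIdeal)

namespace Summit.ResolutionOfSingularities.ResolutionOfSingularities.Theorems.PIDim4

open Literature.AlgebraicGeometry.Resolution
open Literature.AlgebraicGeometry.Resolution.AffinePointBlowup (P A γ coord Wtop ξ)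

namespace ChartDictionary

variable {K : Type} [Field K] {S T : Finset (Fin 4)} {j m : Fin 4} {b : K} {W : Scheme.{0}} {π : W ⟶ P 4 K}

/-! ## §1 One more chart reading: a transversal translated member -/

/-- On the `x_j`-chart of ANY blowing up of `𝔸⁵` along `V(z, x_S)`: the strict transform of a transversal translated member
`(xᵢ + c)·𝒪`, `i ∉ S`, reads `(xᵢ + c)·𝒪`. -/
theorem strictTransformIdeal_translate_comap_chartImm (hj : j ∈ S) {i : Fin 4} (hi : i ∉ S) (c : K)
    (hπ : IsBlowup π (AffineCoordBlowup.𝓘Λ 4 K (insert 0 (Fin.succ '' (S : Set (Fin 4)))))) :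
    (strictTransformIdeal π (AffineCoordBlowup.𝓘Λ 4 K (insert 0 (Fin.succ '' (S : Set (Fin 4)))))
        (ofIdealTop (Ideal.span {(γ 4 K).symm (X i.succ + C c)}))).comap (AffineCoordBlowup.chartImm hπ (succ_mem_centreVars hj)) =
      ofIdealTop (Ideal.span {(γ 4 K).symm (X i.succ + C c)}) := by
  haveI : IsProper π := hπ.isProper
  haveI : IsLocallyNoetherian W := LocallyOfFiniteType.isLocallyNoetherian π
  have hsq : AffineCoordBlowup.chartImm hπ (succ_mem_centreVars hj) ≫ π =
      Spec.map (CommRingCat.ofHom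
        (coordBlowupSubst K (insert 0 (Fin.succ '' (S : Set (Fin 4)))) j.succ).toRingHom) ≫ 𝟙 (P 4 K) := by
    rw [Category.comp_id]
    exact AffineCoordBlowup.chartImm_comp hπ (succ_mem_centreVars hj)
  rw [comap_strictTransformIdeal_of_flat (t := 𝟙 (P 4 K)) hsq, Scheme.IdealSheafData.comap_id,
    Scheme.IdealSheafData.comap_id, strictTransformIdeal_specMap_subst_translate hj hi c]

/-! ## §2 The strict transform of the escaping centre is snc with the transformed boundary -/

/-- **AFTER THE REPAIR BLOW-UP OF `Σ`, `St(Zc)` IS SNC WITH THE TRANSFORMED BOUNDARY.** `m ∈ T`, `j ∉ T`, `b ≠ 0`; `l` a list of indices in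
`Fin 4` with `m, j ∉ l`; constants `c` with `cᵢ = 0` for `i ∈ T`; `E = x_j·𝒪 :: (x_m + b x_j)·𝒪 :: [(xᵢ + cᵢ)·𝒪 : i ∈ l]`; `π'` ANY blowing up of
`𝔸⁵` along `Σ = 𝓘Λ_{insert j T}`. Then `HasSNCWith (E.map (St π') ++ [Σ·𝒪_{W'}]) (St π' 𝓘Λ_T)`. -/
theorem hasSNCWith_transform_boundary_strictTransform_after_repair (hmT : m ∈ T) (hjT : j ∉ T) (hb : b ≠ 0)
    (l : List (Fin 4)) (hml : m ∉ l) (hjl : j ∉ l) (c : Fin 4 → K) (hc : ∀ i ∈ T, c i = 0)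
    (hπ : IsBlowup π (AffineCoordBlowup.𝓘Λ 4 K (insert 0 (Fin.succ '' ((insert j T : Finset (Fin 4)) : Set (Fin 4)))))) :
    HasSNCWith
      (((ofIdealTop (Ideal.span {(γ 4 K).symm (X j.succ)}) ::
          ofIdealTop (Ideal.span {(γ 4 K).symm (X m.succ + C b * X j.succ)}) ::
          l.map fun i => ofIdealTop (Ideal.span {(γ 4 K).symm (X i.succ + C (c i))})).map
          (strictTransformIdeal π (AffineCoordBlowup.𝓘Λ 4 K (insert 0 (Fin.succ '' ((insert j T : Finset (Fin 4)) : Set (Fin 4))))))) ++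
        [(AffineCoordBlowup.𝓘Λ 4 K (insert 0 (Fin.succ '' ((insert j T : Finset (Fin 4)) : Set (Fin 4))))).comap π])
      (strictTransformIdeal π (AffineCoordBlowup.𝓘Λ 4 K (insert 0 (Fin.succ '' ((insert j T : Finset (Fin 4)) : Set (Fin 4)))))
        (AffineCoordBlowup.𝓘Λ 4 K (insert 0 (Fin.succ '' (T : Set (Fin 4)))))) := by
  classical
  haveI : IsProper π := hπ.isProper
  haveI : IsLocallyNoetherian W := LocallyOfFiniteType.isLocallyNoetherian π
  have hmj : m ≠ j := fun e => hjT (e ▸ hmT)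
  have hj' : j ∈ insert j T := Finset.mem_insert_self j T
  have hm' : m ∈ insert j T := Finset.mem_insert_of_mem hmT
  set Λ : Set (Fin (4 + 1)) := insert 0 (Fin.succ '' ((insert j T : Finset (Fin 4)) : Set (Fin 4))) with hΛ
  set ΛT : Set (Fin (4 + 1)) := insert 0 (Fin.succ '' (T : Set (Fin 4))) with hΛT
  have hsub : ΛT ⊆ Λ := by
    refine Set.insert_subset_insert (Set.image_mono ?_)
    rw [Finset.coe_insert]; exact Set.subset_insert _ _
  have hjΛT : j.succ ∉ ΛT := fun h => hjT ((succ_mem_centreVars_iff T j).mp h)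
  have hmΛT : m.succ ∈ ΛT := Set.mem_insert_of_mem _ ⟨m, Finset.mem_coe.mpr hmT, rfl⟩
  have hΛle : Λ ⊆ insert j.succ ΛT := by
    rintro i (rfl | ⟨k, hk, rfl⟩)
    · exact Set.mem_insert_of_mem _ (Set.mem_insert _ _)
    · rw [Finset.coe_insert] at hk
      rcases hk with rfl | hk
      · exact Set.mem_insert _ _
      · exact Set.mem_insert_of_mem _ (Set.mem_insert_of_mem _ ⟨k, hk, rfl⟩)
  -- the constants as a function on `Fin 5`, vanishing at `z` and at `x_j`
  let c5 : Fin (4 + 1) → K := Fin.cases 0 (Function.update c j 0)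
  have hc5succ : ∀ i : Fin 4, i ≠ j → c5 i.succ = c i := fun i hij => by
    change Function.update c j 0 i = c i; rw [Function.update_of_ne hij]
  have hc5j : c5 j.succ = 0 := by change Function.update c j 0 j = 0; rw [Function.update_self]
  have hc5Λ : ∀ i ∈ Λ, c5 i = 0 := by
    rintro i (rfl | ⟨k, hk, rfl⟩)
    · rfl
    · rw [Finset.coe_insert] at hk
      rcases hk with rfl | hk
      · exact hc5j
      · by_cases hkj : k = j
        · rw [hkj]; exact hc5j
        · rw [hc5succ k hkj]; exact hc k hk
  have hc5T : ∀ i ∈ ΛT, c5 i = 0 := fun i hi => hc5Λ i (hsub hi)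
  have hml' : m.succ ∉ l.map Fin.succ ++ [j.succ] := by
    intro h
    rcases List.mem_append.mp h with h | h
    · obtain ⟨k, hk, hkm⟩ := List.mem_map.mp h
      exact hml ((Fin.succ_inj.mp hkm) ▸ hk)
    · rw [List.mem_singleton] at h
      exact hmj (Fin.succ_inj.mp h)
  -- the tail members in both presentations
  have hEl : ((l.map Fin.succ).map fun i => ofIdealTop (Ideal.span {(γ 4 K).symm (X i + C (c5 i))})) =
      l.map fun i => ofIdealTop (Ideal.span {(γ 4 K).symm (X i.succ + C (c i))}) := by
    rw [List.map_map]
    refine List.map_congr_left fun i hi => ?_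
    have hij : i ≠ j := fun e => hjl (e ▸ hi)
    rw [Function.comp_apply, hc5succ i hij]
  -- (i) snc BEFORE the blow-up: `E` has snc with `Σ` (N3); hence the transformed boundary is snc on `W'`
  have hE : HasSNCWith
      (ofIdealTop (Ideal.span {(γ 4 K).symm (X j.succ)}) ::
        ofIdealTop (Ideal.span {(γ 4 K).symm (X m.succ + C b * X j.succ)}) ::
        l.map fun i => ofIdealTop (Ideal.span {(γ 4 K).symm (X i.succ + C (c i))}))
      (AffineCoordBlowup.𝓘Λ 4 K Λ) := by
    rw [← hEl]
    exact hasSNCWith_pair_translatedHyperplanes_𝓘Λ_insert hmT hmj b (l.map Fin.succ)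
      (fun h => hml' (List.mem_append.mpr (Or.inl h))) c5 hc5Λ
  have hsncW := hE.hasSNC_transform hπ
  -- (ii) AFTER, on the `x_j`-chart: dead `St(x_j)`, moved bad member, the tail, the exceptional divisor
  have key : HasSNCWith (⊤ :: ofIdealTop (Ideal.span {(γ 4 K).symm (X m.succ + C b)}) ::
      (l.map Fin.succ ++ [j.succ]).map fun i => ofIdealTop (Ideal.span {(γ 4 K).symm (X i + C (c5 i))}))
      (AffineCoordBlowup.𝓘Λ 4 K ΛT) := by
    have h := hasSNCWith_afterRepair_translatedHyperplanes_𝓘Λ (K := K) (T := T) (j := j) (m := m) (b := b)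
      (β := fun _ => (0 : K)) (c := c5) hmT hb rfl (fun _ _ => rfl) hc5T (l.map Fin.succ ++ [j.succ]) hml'
    simpa only [C_0, zero_mul, add_zero] using h
  -- the chart readings of the transformed members
  have hG : ∀ i ∈ l, (strictTransformIdeal π (AffineCoordBlowup.𝓘Λ 4 K Λ)
      (ofIdealTop (Ideal.span {(γ 4 K).symm (X i.succ + C (c i))}))).comap (AffineCoordBlowup.chartImm hπ (succ_mem_centreVars hj')) =
      ofIdealTop (Ideal.span {(γ 4 K).symm (X i.succ + C (c i))}) := by
    intro i hi
    have hij : i ≠ j := fun e => hjl (e ▸ hi)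
    by_cases hci : c i = 0
    · rw [hci, C_0, add_zero]
      exact strictTransformIdeal_hyperplane_comap_chartImm hj' hij hπ
    · have hiS : i ∉ insert j T := fun h => by
        rcases Finset.mem_insert.mp h with h | h
        · exact hij h
        · exact hci (hc i h)
      exact strictTransformIdeal_translate_comap_chartImm hj' hiS (c i) hπ
  -- (iii) glue over the single chart `x_j`
  refine hasSNCWith_of_cover_comap (fun _ : Unit => AffineCoordBlowup.chartImm hπ (succ_mem_centreVars hj')) hsncW ?_ fun _ => ?_
  · intro w hw
    exact Set.mem_iUnion.mpr ⟨(), support_strictTransformIdeal_𝓘Λ_subset_opensRange hπ hsub (succ_mem_centreVars hj') hΛle hw⟩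
  · rw [comap_chartImm_strictTransformIdeal_𝓘Λ_of_subset hπ hsub (succ_mem_centreVars hj') hjΛT, List.map_append, List.map_map,
      List.map_cons, List.map_cons, List.map_map, List.map_cons, List.map_nil, Function.comp_apply, Function.comp_apply,
      show (γ 4 K).symm (X j.succ) = coord 4 K j.succ from rfl, strictTransformIdeal_hyperplane_self_comap_chartImm hj' hπ,
      strictTransformIdeal_shear_comap_chartImm hj' hm' hmj b hπ, comap_𝓘Λ_chartImm hj' hπ,
      show List.map (((fun x : W.IdealSheafData => x.comap (AffineCoordBlowup.chartImm hπ (succ_mem_centreVars hj'))) ∘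
          strictTransformIdeal π (AffineCoordBlowup.𝓘Λ 4 K Λ)) ∘
          fun i : Fin 4 => ofIdealTop (Ideal.span {(γ 4 K).symm (X i.succ + C (c i))})) l =
        List.map (fun i => ofIdealTop (Ideal.span {(γ 4 K).symm (X i.succ + C (c i))})) l from
        List.map_congr_left fun i hi => hG i hi]
    rw [List.map_append, List.map_cons, List.map_nil, hEl] at key
    have hlast : ofIdealTop (Ideal.span {(γ 4 K).symm (X j.succ + C (c5 j.succ))}) = ofIdealTop (Ideal.span {coord 4 K j.succ}) := by
      rw [hc5j, C_0, add_zero]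
      rfl
    rw [hlast] at key
    exact key

end ChartDictionary

end Summit.ResolutionOfSingularities.ResolutionOfSingularities.Theorems.PIDim4

end
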